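import Literature.InformationTheory.StateDiscrimination.QuantumFisherInformationMatrix
import HarnessLib

/-!
# The quantum geometric tensor of a pure state: `Re Q = 𝓕/4`, `⟨ψ|L_aL_b|ψ⟩ = 4Q_ab`, the pure-state
# attainability condition `⟨ψ|[L_a,L_b]|ψ⟩ = 0 ⇔ Im⟨∂_aψ|∂_bψ⟩ = 0`, and unitary processes with a pure probe
# (Liu–Yuan–Lu–Wang 2020 § 2.4.3, § 3.1.2 Thm 3.2 (pure-state form) with Cor. 10, § 2.3.4 Cor. 3)

Hodge foundations lane (`lit-hodgefound`, prover p24 gen 80; quantum-information series).  THEOREMS ONLY: no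
definition, no named fact, net debt 0.  Pure-state vocabulary of `QuantumFisherInformationProductPure.lean`
(p24 g78) and `QuantumFisherInformationMatrix.lean` (g80-#1): a unit vector `ψ` (`⟨ψ|ψ⟩ = 1`), derivative
vectors `ψ' a = |∂_aψ⟩` with `⟨ψ|∂_aψ⟩ + ⟨∂_aψ|ψ⟩ = 0` (differentiate `⟨ψ|ψ⟩ = 1`), the state
`ρ = |ψ⟩⟨ψ| = vecMulVec ψ (star ψ)`, derivative data `∂_aρ = |∂_aψ⟩⟨ψ| + |ψ⟩⟨∂_aψ|`, Bertlmann–Friis SLDs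
`S a` (`S_aρ + ρS_a = ∂_aρ`, `L_a = 2S_a`), the QFIM `hF : F a b = 2 Re Tr(S_a ∂_bρ)`, and the quantum geometric
tensor as the complex matrix `hQ : Q a b = ⟨∂_aψ|∂_bψ⟩ − ⟨∂_aψ|ψ⟩⟨ψ|∂_bψ⟩` (`⟨u|v⟩ = star u ⬝ᵥ v`).

## Source, VERBATIM

J. Liu, H. Yuan, X.-M. Lu, X. Wang, *Quantum Fisher information matrix and multiparameter estimation*, J. Phys. A
53 (2020) 023001 [LiuYuanLuWang2020], held `paper:arxiv-1907.08037`.  § 2.4.3 (p0011–p0012): «For a pure state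
`|ψ⟩ = |ψ(x⃗)⟩`, the quantum geometric tensor `Q` is defined as [Provost1980, Venuti2007]
`Q_μν = ⟨∂_μψ|∂_νψ⟩ − ⟨∂_μψ|ψ⟩⟨ψ|∂_νψ⟩`. Recall the expression of QFIM for pure states … the real part of `Q_μν`
is actually the QFIM up to a constant factor, i.e., `Re(Q_μν) = ¼𝓕_μν`. In the mean time, due to the fact that
`(⟨∂_μψ|ψ⟩⟨ψ|∂_νψ⟩)* = ⟨ψ|∂_μψ⟩⟨∂_νψ|ψ⟩ = ⟨∂_μψ|ψ⟩⟨ψ|∂_νψ⟩`, i.e., `⟨∂_μψ|ψ⟩⟨ψ|∂_νψ⟩` is real, the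
imaginary part of `Q_μν` then reads `Im(Q_μν) = Im(⟨∂_μψ|∂_νψ⟩) = −½(∂_μ𝒜_ν − ∂_ν𝒜_μ)`, where `𝒜_μ := i⟨ψ|∂_μψ⟩`
is the Berry connection».  § 3.1.2 (p0015): «**Theorem 3.2** The necessary and sufficient condition for the
saturation of the quantum multiparameter Cramér-Rao bound is `Tr(ρ[L_a,L_b]) = 0, ∀a,b`. For a pure parameterized
state `|ψ⟩ := |ψ(x⃗)⟩`, this condition reduces to `⟨ψ|[L_a,L_b]|ψ⟩ = 0, ∀a,b`, which is equivalent to the form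
`Im(⟨∂_aψ|∂_bψ⟩) = 0`. … **Corollary 10** For a unitary process `U` with a pure probe state `|ψ₀⟩`, the necessary
and sufficient condition for the attainability of quantum multiparameter Cramér-Rao bound is
`⟨ψ₀|[𝓗_a,𝓗_b]|ψ₀⟩ = 0, ∀a,b`.»  § 2.3.4 (p0008): «The operator `𝓗_a` is defined as [Taddei2013, Boixo2007]
`𝓗_a := i(∂_aU†)U = −iU†(∂_aU)`. `𝓗_a` is a Hermitian operator … **Corollary 3** For a unitary process `U` with a
pure probe state `|ψ₀⟩`, the entry of QFIM is in the form `𝓕_ab = 4cov_{|ψ₀⟩}(𝓗_a,𝓗_b)`», with (p0007)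
«`cov_{|ψ⟩}(A,B) := ½⟨ψ|{A,B}|ψ⟩ − ⟨ψ|A|ψ⟩⟨ψ|B|ψ⟩`».

## Roads (no definitions introduced)

* § 1 The printed reality of `⟨∂_aψ|ψ⟩⟨ψ|∂_bψ⟩` (from `⟨ψ|∂ψ⟩ + ⟨∂ψ|ψ⟩ = 0`), `Re Q_ab = ¼F_ab` (this is g80-#1
  `qfim_pure`, Liu Thm 2.5), `Im Q_ab = Im⟨∂_aψ|∂_bψ⟩`, `Q_ba = Q̄_ab`.
* § 2 For ANY SLDs: `S_a|ψ⟩ = |∂_aψ⟩ + ⟨∂_aψ|ψ⟩|ψ⟩` (g78 `sld_pure_apply`), hence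
  **`⟨ψ|S_aS_b|ψ⟩ = Q_ab`** (`⟨ψ|L_aL_b|ψ⟩ = 4Q_ab`): the QGT is the (SLD-choice-independent) second moment of the
  SLDs in the state; so `⟨ψ|{S_a,S_b}|ψ⟩ = 2Re Q_ab = F_ab/2` and `⟨ψ|[S_a,S_b]|ψ⟩ = 2i Im⟨∂_aψ|∂_bψ⟩`, which
  gives the pure-state form of Thm 3.2: **`⟨ψ|[L_a,L_b]|ψ⟩ = 0 ⇔ Im⟨∂_aψ|∂_bψ⟩ = 0`**.
* § 3 Unitary processes `|ψ⟩ = U|ψ₀⟩`, `|∂_aψ⟩ = (∂_aU)|ψ₀⟩ = iU𝓗_a|ψ₀⟩` (`U†U = 1`, `𝓗_a` Hermitian): the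
  normalisation condition holds automatically, `⟨∂_aψ|∂_bψ⟩ = ⟨ψ₀|𝓗_a𝓗_b|ψ₀⟩`, `⟨∂_aψ|ψ⟩ = −i⟨ψ₀|𝓗_a|ψ₀⟩`, so
  `Q_ab = ⟨𝓗_a𝓗_b⟩ − ⟨𝓗_a⟩⟨𝓗_b⟩`, **Cor. 3** `F_ab = 4cov(𝓗_a,𝓗_b)` and **Cor. 10**
  `Im⟨∂_aψ|∂_bψ⟩ = 0 ⇔ ⟨ψ₀|[𝓗_a,𝓗_b]|ψ₀⟩ = 0`.

## What is formalized (all PROVED)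

* § 1 `star_inner_deriv`, `star_inner_deriv_mul_inner_deriv` (reality), **`qfim_eq_four_re_qgt`** (`F_ab = 4Re Q_ab`),
  `im_qgt_eq`, `qgt_conj_symm`.
* § 2 `sld_mulVec_pure`, **`inner_sld_mul_sld_pure`** (`⟨ψ|S_aS_b|ψ⟩ = Q_ab`), `trace_pure_mul_sld_mul_sld`,
  `inner_anticomm_sld_pure`, **`inner_comm_sld_pure`** (`⟨ψ|[S_a,S_b]|ψ⟩ = 2i·Im⟨∂_aψ|∂_bψ⟩`),
  **`inner_comm_sld_pure_eq_zero_iff`** (Thm 3.2, pure-state form).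
* § 3 `unitary_inner`, `norm_unitary_probe`, `re_inner_deriv_unitary`, `inner_deriv_deriv_unitary`,
  `inner_deriv_probe_unitary`, **`qgt_unitary`** (`Q_ab = ⟨𝓗_a𝓗_b⟩ − ⟨𝓗_a⟩⟨𝓗_b⟩`), **`qfim_unitary_pure`** (Cor. 3),
  **`im_inner_deriv_unitary_eq_zero_iff`** (Cor. 10).

NOT formalized: the general (mixed-state) Thm 3.2 / Holevo-bound attainability, the Berry-curvature identity
`Im Q = −½(∂_μ𝒜_ν − ∂_ν𝒜_μ)` (second derivatives), Thm 2.7 (mixed probe).  Tree search (FAIL-DUP, 2026-09-01):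
`rg -il "geometric tensor|Berry" Literature/InformationTheory` → none for the QGT; the pure-state QFI/QFIM are g78
`QFI.qfi_pure` / g80-#1 `QFIM.qfim_pure` and are used, not restated.
-/

noncomputable section

open Matrix Finset
open scoped ComplexConjugate

namespace Literature.InformationTheory.StateDiscrimination.PureQGT

open Literature.InformationTheory.StateDiscrimination.QFI (sld_pure_apply trace_mul_ketbra)
open Literature.InformationTheory.StateDiscrimination.QFIM (qfim_pure)

variable {n ι : Type*} [Fintype n]

/-! ## § 1 The quantum geometric tensor: `Re Q = 𝓕/4`, `Im Q = Im⟨∂_aψ|∂_bψ⟩` -/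

/-- `⟨∂_aψ|ψ⟩ = conj⟨ψ|∂_aψ⟩ = −⟨ψ|∂_aψ⟩` from `⟨ψ|∂_aψ⟩ + ⟨∂_aψ|ψ⟩ = 0`. [cite: LiuYuanLuWang2020, §2.4.3] -/
theorem star_inner_deriv {ψ ψ' : n → ℂ} (hre : star ψ ⬝ᵥ ψ' + star ψ' ⬝ᵥ ψ = 0) :
    star (star ψ ⬝ᵥ ψ') = star ψ' ⬝ᵥ ψ ∧ star ψ' ⬝ᵥ ψ = -(star ψ ⬝ᵥ ψ') := by
  refine ⟨by rw [← star_dotProduct_star, star_star, dotProduct_comm], ?_⟩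
  linear_combination hre

/-- **`⟨∂_aψ|ψ⟩⟨ψ|∂_bψ⟩` is real** («`(⟨∂_μψ|ψ⟩⟨ψ|∂_νψ⟩)* = … = ⟨∂_μψ|ψ⟩⟨ψ|∂_νψ⟩`»).
[cite: LiuYuanLuWang2020, §2.4.3] -/
theorem star_inner_deriv_mul_inner_deriv {ψ : n → ℂ} {ψ' : ι → n → ℂ}
    (hre : ∀ a, star ψ ⬝ᵥ ψ' a + star (ψ' a) ⬝ᵥ ψ = 0) (a b : ι) :
    star ((star (ψ' a) ⬝ᵥ ψ) * (star ψ ⬝ᵥ ψ' b)) = (star (ψ' a) ⬝ᵥ ψ) * (star ψ ⬝ᵥ ψ' b) := by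
  obtain ⟨hsa, hna⟩ := star_inner_deriv (hre a)
  obtain ⟨hsb, hnb⟩ := star_inner_deriv (hre b)
  have h1 : star (star (ψ' a) ⬝ᵥ ψ) = star ψ ⬝ᵥ ψ' a := by rw [← hsa, star_star]
  rw [star_mul, hsb, h1, hnb, hna]
  ring

/-- **`Re(Q_μν) = ¼𝓕_μν`**: `F_ab = 4 Re Q_ab` for `ρ = |ψ⟩⟨ψ|` and any SLDs (Liu Thm 2.5 = g80-#1 `qfim_pure`).
[cite: LiuYuanLuWang2020, §2.4.3 («`Re(Q_μν) = ¼𝓕_μν`»)] -/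
theorem qfim_eq_four_re_qgt [DecidableEq n] {ψ : n → ℂ} {ψ' : ι → n → ℂ} (hψ : star ψ ⬝ᵥ ψ = 1)
    (hre : ∀ a, star ψ ⬝ᵥ ψ' a + star (ψ' a) ⬝ᵥ ψ = 0) {S : ι → Matrix n n ℂ}
    (hSD : ∀ a, S a * vecMulVec ψ (star ψ) + vecMulVec ψ (star ψ) * S a =
      vecMulVec (ψ' a) (star ψ) + vecMulVec ψ (star (ψ' a)))
    {F : Matrix ι ι ℝ}
    (hF : ∀ a b, F a b = 2 * (S a * (vecMulVec (ψ' b) (star ψ) + vecMulVec ψ (star (ψ' b)))).trace.re)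
    {Q : Matrix ι ι ℂ} (hQ : ∀ a b, Q a b = star (ψ' a) ⬝ᵥ ψ' b - (star (ψ' a) ⬝ᵥ ψ) * (star ψ ⬝ᵥ ψ' b))
    (a b : ι) : F a b = 4 * (Q a b).re := by
  rw [hQ]
  exact qfim_pure hψ hre hSD hF a b

/-- **`Im(Q_μν) = Im⟨∂_μψ|∂_νψ⟩`** (the subtracted term is real). [cite: LiuYuanLuWang2020, §2.4.3] -/
theorem im_qgt_eq {ψ : n → ℂ} {ψ' : ι → n → ℂ} (hre : ∀ a, star ψ ⬝ᵥ ψ' a + star (ψ' a) ⬝ᵥ ψ = 0)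
    {Q : Matrix ι ι ℂ} (hQ : ∀ a b, Q a b = star (ψ' a) ⬝ᵥ ψ' b - (star (ψ' a) ⬝ᵥ ψ) * (star ψ ⬝ᵥ ψ' b))
    (a b : ι) : (Q a b).im = (star (ψ' a) ⬝ᵥ ψ' b).im := by
  have hreal := star_inner_deriv_mul_inner_deriv hre a b
  rw [Complex.star_def] at hreal
  rw [hQ, Complex.sub_im, Complex.conj_eq_iff_im.mp hreal, sub_zero]

/-- **`Q_ba = Q̄_ab`** (the QGT is a Hermitian tensor). [cite: LiuYuanLuWang2020, §2.4.3] -/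
theorem qgt_conj_symm {ψ : n → ℂ} {ψ' : ι → n → ℂ} (hre : ∀ a, star ψ ⬝ᵥ ψ' a + star (ψ' a) ⬝ᵥ ψ = 0)
    {Q : Matrix ι ι ℂ} (hQ : ∀ a b, Q a b = star (ψ' a) ⬝ᵥ ψ' b - (star (ψ' a) ⬝ᵥ ψ) * (star ψ ⬝ᵥ ψ' b))
    (a b : ι) : Q b a = star (Q a b) := by
  obtain ⟨hsa, hna⟩ := star_inner_deriv (hre a)
  obtain ⟨hsb, hnb⟩ := star_inner_deriv (hre b)
  have hG : star (star (ψ' a) ⬝ᵥ ψ' b) = star (ψ' b) ⬝ᵥ ψ' a := by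
    rw [← star_dotProduct_star, star_star, dotProduct_comm]
  have h1 : star (star (ψ' a) ⬝ᵥ ψ) = star ψ ⬝ᵥ ψ' a := by rw [← hsa, star_star]
  rw [hQ, hQ, star_sub, hG, star_mul, hsb, h1]

/-! ## § 2 `⟨ψ|S_aS_b|ψ⟩ = Q_ab` for any SLDs; the pure-state attainability condition (Thm 3.2) -/

/-- **`S_a|ψ⟩ = |∂_aψ⟩ + ⟨∂_aψ|ψ⟩|ψ⟩`** for every solution of the pure-state SLD equation (and `⟨ψ|S_a|ψ⟩ = 0`).
[cite: LiuYuanLuWang2020, §2.3.2 Thm 2.5 («`L_a = 2(|ψ⟩⟨∂_aψ| + |∂_aψ⟩⟨ψ|)`»)] -/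
theorem sld_mulVec_pure {ψ : n → ℂ} {ψ' : ι → n → ℂ} (hψ : star ψ ⬝ᵥ ψ = 1)
    (hre : ∀ a, star ψ ⬝ᵥ ψ' a + star (ψ' a) ⬝ᵥ ψ = 0) {S : ι → Matrix n n ℂ}
    (hSD : ∀ a, S a * vecMulVec ψ (star ψ) + vecMulVec ψ (star ψ) * S a =
      vecMulVec (ψ' a) (star ψ) + vecMulVec ψ (star (ψ' a))) (a : ι) :
    S a *ᵥ ψ = ψ' a + (star (ψ' a) ⬝ᵥ ψ) • ψ :=
  (sld_pure_apply hψ (hre a) (hSD a)).2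

/-- **`⟨ψ|S_aS_b|ψ⟩ = Q_ab`** (so `⟨ψ|L_aL_b|ψ⟩ = 4Q_ab`) for Hermitian SLDs of a pure state — the quantum geometric
tensor is the second moment of the SLDs, whichever solutions are chosen. [cite: LiuYuanLuWang2020, §2.4.3 and §3.1.2 Thm 3.2] -/
theorem inner_sld_mul_sld_pure {ψ : n → ℂ} {ψ' : ι → n → ℂ} (hψ : star ψ ⬝ᵥ ψ = 1)
    (hre : ∀ a, star ψ ⬝ᵥ ψ' a + star (ψ' a) ⬝ᵥ ψ = 0) {S : ι → Matrix n n ℂ} (hS : ∀ a, (S a).IsHermitian)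
    (hSD : ∀ a, S a * vecMulVec ψ (star ψ) + vecMulVec ψ (star ψ) * S a =
      vecMulVec (ψ' a) (star ψ) + vecMulVec ψ (star (ψ' a)))
    {Q : Matrix ι ι ℂ} (hQ : ∀ a b, Q a b = star (ψ' a) ⬝ᵥ ψ' b - (star (ψ' a) ⬝ᵥ ψ) * (star ψ ⬝ᵥ ψ' b))
    (a b : ι) : star ψ ⬝ᵥ ((S a * S b) *ᵥ ψ) = Q a b := by
  -- `⟨ψ|S_aS_bψ⟩ = ⟨S_aψ|S_bψ⟩`
  have h1 : star ψ ⬝ᵥ ((S a * S b) *ᵥ ψ) = star (S a *ᵥ ψ) ⬝ᵥ (S b *ᵥ ψ) := by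
    rw [← mulVec_mulVec, dotProduct_mulVec, star_mulVec, (hS a).eq]
  obtain ⟨hsa, hna⟩ := star_inner_deriv (hre a)
  obtain ⟨hsb, hnb⟩ := star_inner_deriv (hre b)
  rw [h1, sld_mulVec_pure hψ hre hSD a, sld_mulVec_pure hψ hre hSD b, hQ]
  have h1a : star (star (ψ' a) ⬝ᵥ ψ) = star ψ ⬝ᵥ ψ' a := by rw [← hsa, star_star]
  simp only [star_add, star_smul, add_dotProduct, dotProduct_add, smul_dotProduct, dotProduct_smul, smul_eq_mul, hψ,
    mul_one]
  rw [h1a, hna, hnb]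
  ring

/-- The same in trace form: `Tr(|ψ⟩⟨ψ| S_aS_b) = Q_ab`. [cite: LiuYuanLuWang2020, §3.1.2 Thm 3.2 («`Tr(ρ[L_a,L_b])`»)] -/
theorem trace_pure_mul_sld_mul_sld {ψ : n → ℂ} {ψ' : ι → n → ℂ} (hψ : star ψ ⬝ᵥ ψ = 1)
    (hre : ∀ a, star ψ ⬝ᵥ ψ' a + star (ψ' a) ⬝ᵥ ψ = 0) {S : ι → Matrix n n ℂ} (hS : ∀ a, (S a).IsHermitian)
    (hSD : ∀ a, S a * vecMulVec ψ (star ψ) + vecMulVec ψ (star ψ) * S a =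
      vecMulVec (ψ' a) (star ψ) + vecMulVec ψ (star (ψ' a)))
    {Q : Matrix ι ι ℂ} (hQ : ∀ a b, Q a b = star (ψ' a) ⬝ᵥ ψ' b - (star (ψ' a) ⬝ᵥ ψ) * (star ψ ⬝ᵥ ψ' b))
    (a b : ι) : (vecMulVec ψ (star ψ) * (S a * S b)).trace = Q a b := by
  rw [Matrix.trace_mul_comm, trace_mul_ketbra, inner_sld_mul_sld_pure hψ hre hS hSD hQ]

/-- `⟨ψ|{S_a,S_b}|ψ⟩ = Q_ab + Q̄_ab = 2Re Q_ab` (`= F_ab/2`). [cite: LiuYuanLuWang2020, §2.4.3] -/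
theorem inner_anticomm_sld_pure {ψ : n → ℂ} {ψ' : ι → n → ℂ} (hψ : star ψ ⬝ᵥ ψ = 1)
    (hre : ∀ a, star ψ ⬝ᵥ ψ' a + star (ψ' a) ⬝ᵥ ψ = 0) {S : ι → Matrix n n ℂ} (hS : ∀ a, (S a).IsHermitian)
    (hSD : ∀ a, S a * vecMulVec ψ (star ψ) + vecMulVec ψ (star ψ) * S a =
      vecMulVec (ψ' a) (star ψ) + vecMulVec ψ (star (ψ' a)))
    {Q : Matrix ι ι ℂ} (hQ : ∀ a b, Q a b = star (ψ' a) ⬝ᵥ ψ' b - (star (ψ' a) ⬝ᵥ ψ) * (star ψ ⬝ᵥ ψ' b))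
    (a b : ι) : star ψ ⬝ᵥ ((S a * S b + S b * S a) *ᵥ ψ) = 2 * ((Q a b).re : ℂ) := by
  rw [add_mulVec, dotProduct_add, inner_sld_mul_sld_pure hψ hre hS hSD hQ, inner_sld_mul_sld_pure hψ hre hS hSD hQ,
    qgt_conj_symm hre hQ a b, Complex.star_def, Complex.add_conj, Complex.ofReal_mul, Complex.ofReal_ofNat]

/-- **`⟨ψ|[S_a,S_b]|ψ⟩ = 2i Im⟨∂_aψ|∂_bψ⟩`** (i.e. `⟨ψ|[L_a,L_b]|ψ⟩ = 8i Im⟨∂_aψ|∂_bψ⟩` with `L = 2S`), for any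
Hermitian SLDs of the pure state. [cite: LiuYuanLuWang2020, §3.1.2 Thm 3.2 («`⟨ψ|[L_a,L_b]|ψ⟩ = 0` … equivalent to `Im(⟨∂_aψ|∂_bψ⟩) = 0`»)] -/
theorem inner_comm_sld_pure {ψ : n → ℂ} {ψ' : ι → n → ℂ} (hψ : star ψ ⬝ᵥ ψ = 1)
    (hre : ∀ a, star ψ ⬝ᵥ ψ' a + star (ψ' a) ⬝ᵥ ψ = 0) {S : ι → Matrix n n ℂ} (hS : ∀ a, (S a).IsHermitian)
    (hSD : ∀ a, S a * vecMulVec ψ (star ψ) + vecMulVec ψ (star ψ) * S a =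
      vecMulVec (ψ' a) (star ψ) + vecMulVec ψ (star (ψ' a))) (a b : ι) :
    star ψ ⬝ᵥ ((S a * S b - S b * S a) *ᵥ ψ) = 2 * Complex.I * ((star (ψ' a) ⬝ᵥ ψ' b).im : ℂ) := by
  obtain ⟨Q, hQ⟩ : ∃ Q : Matrix ι ι ℂ, ∀ a b, Q a b = star (ψ' a) ⬝ᵥ ψ' b - (star (ψ' a) ⬝ᵥ ψ) * (star ψ ⬝ᵥ ψ' b) :=
    ⟨Matrix.of fun a b => star (ψ' a) ⬝ᵥ ψ' b - (star (ψ' a) ⬝ᵥ ψ) * (star ψ ⬝ᵥ ψ' b), fun _ _ => rfl⟩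
  rw [sub_mulVec, dotProduct_sub, inner_sld_mul_sld_pure hψ hre hS hSD hQ, inner_sld_mul_sld_pure hψ hre hS hSD hQ,
    qgt_conj_symm hre hQ a b, Complex.star_def, Complex.sub_conj, im_qgt_eq hre hQ]
  push_cast
  ring

/-- **Theorem 3.2, pure-state form**: for `ρ = |ψ⟩⟨ψ|` and any Hermitian SLDs, `⟨ψ|[S_a,S_b]|ψ⟩ = 0`
(`⇔ ⟨ψ|[L_a,L_b]|ψ⟩ = 0`) if and only if `Im⟨∂_aψ|∂_bψ⟩ = 0`. [cite: LiuYuanLuWang2020, §3.1.2 Thm 3.2] -/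
theorem inner_comm_sld_pure_eq_zero_iff {ψ : n → ℂ} {ψ' : ι → n → ℂ} (hψ : star ψ ⬝ᵥ ψ = 1)
    (hre : ∀ a, star ψ ⬝ᵥ ψ' a + star (ψ' a) ⬝ᵥ ψ = 0) {S : ι → Matrix n n ℂ} (hS : ∀ a, (S a).IsHermitian)
    (hSD : ∀ a, S a * vecMulVec ψ (star ψ) + vecMulVec ψ (star ψ) * S a =
      vecMulVec (ψ' a) (star ψ) + vecMulVec ψ (star (ψ' a))) (a b : ι) :
    star ψ ⬝ᵥ ((S a * S b - S b * S a) *ᵥ ψ) = 0 ↔ (star (ψ' a) ⬝ᵥ ψ' b).im = 0 := by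
  rw [inner_comm_sld_pure hψ hre hS hSD, mul_eq_zero, mul_eq_zero, Complex.ofReal_eq_zero]
  simp [Complex.I_ne_zero]

/-! ## § 3 Unitary processes with a pure probe (Cor. 3 and Cor. 10) -/

section Unitary

variable [DecidableEq n]

/-- `⟨Uv|Uw⟩ = ⟨v|w⟩` for `U†U = 1`. [folklore] -/
private theorem unitary_inner {U : Matrix n n ℂ} (hU : Uᴴ * U = 1) (v w : n → ℂ) :
    star (U *ᵥ v) ⬝ᵥ (U *ᵥ w) = star v ⬝ᵥ w := by
  rw [star_mulVec, ← dotProduct_mulVec, mulVec_mulVec, hU, one_mulVec]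

/-- `|ψ⟩ = U|ψ₀⟩` is a unit vector. [cite: LiuYuanLuWang2020, §2.3.4 («`ρ = Uρ₀U†`»)] -/
theorem norm_unitary_probe {U : Matrix n n ℂ} (hU : Uᴴ * U = 1) {ψ₀ : n → ℂ} (hψ₀ : star ψ₀ ⬝ᵥ ψ₀ = 1) :
    star (U *ᵥ ψ₀) ⬝ᵥ (U *ᵥ ψ₀) = 1 := by
  rw [unitary_inner hU, hψ₀]

/-- **`⟨∂_aψ|∂_bψ⟩ = ⟨ψ₀|𝓗_a𝓗_b|ψ₀⟩`** for `|∂_aψ⟩ = iU𝓗_a|ψ₀⟩` (`𝓗_a` Hermitian, `U†U = 1`).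
[cite: LiuYuanLuWang2020, §2.3.4 («`𝓗_a := i(∂_aU†)U = −iU†(∂_aU)`»)] -/
theorem inner_deriv_deriv_unitary {U : Matrix n n ℂ} (hU : Uᴴ * U = 1) {Hc : ι → Matrix n n ℂ}
    (hH : ∀ a, (Hc a).IsHermitian) (ψ₀ : n → ℂ) (a b : ι) :
    star (Complex.I • (U *ᵥ (Hc a *ᵥ ψ₀))) ⬝ᵥ (Complex.I • (U *ᵥ (Hc b *ᵥ ψ₀))) =
      star ψ₀ ⬝ᵥ ((Hc a * Hc b) *ᵥ ψ₀) := by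
  rw [star_smul, smul_dotProduct, dotProduct_smul, unitary_inner hU, star_mulVec, (hH a).eq, ← dotProduct_mulVec,
    mulVec_mulVec, Complex.star_def, Complex.conj_I, smul_smul]
  simp

/-- **`⟨∂_aψ|ψ⟩ = −i⟨ψ₀|𝓗_a|ψ₀⟩`** and `⟨ψ|∂_aψ⟩ = i⟨ψ₀|𝓗_a|ψ₀⟩`. [cite: LiuYuanLuWang2020, §2.3.4] -/
theorem inner_deriv_probe_unitary {U : Matrix n n ℂ} (hU : Uᴴ * U = 1) {Hc : ι → Matrix n n ℂ}
    (hH : ∀ a, (Hc a).IsHermitian) (ψ₀ : n → ℂ) (a : ι) :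
    star (Complex.I • (U *ᵥ (Hc a *ᵥ ψ₀))) ⬝ᵥ (U *ᵥ ψ₀) = -Complex.I * (star ψ₀ ⬝ᵥ (Hc a *ᵥ ψ₀)) ∧
    star (U *ᵥ ψ₀) ⬝ᵥ (Complex.I • (U *ᵥ (Hc a *ᵥ ψ₀))) = Complex.I * (star ψ₀ ⬝ᵥ (Hc a *ᵥ ψ₀)) := by
  constructor
  · rw [star_smul, smul_dotProduct, unitary_inner hU, star_mulVec, (hH a).eq, ← dotProduct_mulVec, Complex.star_def,
      Complex.conj_I, smul_eq_mul]
  · rw [dotProduct_smul, unitary_inner hU, smul_eq_mul]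

/-- The normalisation condition `⟨ψ|∂_aψ⟩ + ⟨∂_aψ|ψ⟩ = 0` holds automatically for a unitary process.
[cite: LiuYuanLuWang2020, §2.3.4 («`𝓗_a` is a Hermitian operator»)] -/
theorem re_inner_deriv_unitary {U : Matrix n n ℂ} (hU : Uᴴ * U = 1) {Hc : ι → Matrix n n ℂ}
    (hH : ∀ a, (Hc a).IsHermitian) (ψ₀ : n → ℂ) (a : ι) :
    star (U *ᵥ ψ₀) ⬝ᵥ (Complex.I • (U *ᵥ (Hc a *ᵥ ψ₀))) +
      star (Complex.I • (U *ᵥ (Hc a *ᵥ ψ₀))) ⬝ᵥ (U *ᵥ ψ₀) = 0 := by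
  obtain ⟨h1, h2⟩ := inner_deriv_probe_unitary hU hH ψ₀ a
  rw [h1, h2]
  ring

/-- **The QGT of a unitary process with a pure probe is the complex covariance of the generators**:
`Q_ab = ⟨ψ₀|𝓗_a𝓗_b|ψ₀⟩ − ⟨ψ₀|𝓗_a|ψ₀⟩⟨ψ₀|𝓗_b|ψ₀⟩`. [cite: LiuYuanLuWang2020, §2.3.4 Cor. 3 and §2.4.3] -/
theorem qgt_unitary {U : Matrix n n ℂ} (hU : Uᴴ * U = 1) {Hc : ι → Matrix n n ℂ} (hH : ∀ a, (Hc a).IsHermitian)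
    (ψ₀ : n → ℂ) {Q : Matrix ι ι ℂ}
    (hQ : ∀ a b, Q a b = star (Complex.I • (U *ᵥ (Hc a *ᵥ ψ₀))) ⬝ᵥ (Complex.I • (U *ᵥ (Hc b *ᵥ ψ₀))) -
      (star (Complex.I • (U *ᵥ (Hc a *ᵥ ψ₀))) ⬝ᵥ (U *ᵥ ψ₀)) * (star (U *ᵥ ψ₀) ⬝ᵥ (Complex.I • (U *ᵥ (Hc b *ᵥ ψ₀)))))
    (a b : ι) :
    Q a b = star ψ₀ ⬝ᵥ ((Hc a * Hc b) *ᵥ ψ₀) - (star ψ₀ ⬝ᵥ (Hc a *ᵥ ψ₀)) * (star ψ₀ ⬝ᵥ (Hc b *ᵥ ψ₀)) := by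
  rw [hQ, inner_deriv_deriv_unitary hU hH, (inner_deriv_probe_unitary hU hH ψ₀ a).1,
    (inner_deriv_probe_unitary hU hH ψ₀ b).2]
  have : -Complex.I * (star ψ₀ ⬝ᵥ Hc a *ᵥ ψ₀) * (Complex.I * (star ψ₀ ⬝ᵥ Hc b *ᵥ ψ₀)) =
      (star ψ₀ ⬝ᵥ Hc a *ᵥ ψ₀) * (star ψ₀ ⬝ᵥ Hc b *ᵥ ψ₀) := by
    have hI : -Complex.I * Complex.I = 1 := by rw [neg_mul, Complex.I_mul_I, neg_neg]
    linear_combination (star ψ₀ ⬝ᵥ Hc a *ᵥ ψ₀) * (star ψ₀ ⬝ᵥ Hc b *ᵥ ψ₀) * hI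
  rw [this]

omit [DecidableEq n] in
/-- Expectations of Hermitian operators are real: `⟨ψ|A|ψ⟩ = conj⟨ψ|A|ψ⟩`. [folklore] -/
private theorem star_expect {A : Matrix n n ℂ} (hA : A.IsHermitian) (ψ : n → ℂ) :
    star (star ψ ⬝ᵥ (A *ᵥ ψ)) = star ψ ⬝ᵥ (A *ᵥ ψ) := by
  rw [← star_dotProduct_star, star_star, star_mulVec, hA.eq, ← dotProduct_mulVec]

/-- **Corollary 3: `𝓕_ab = 4cov_{|ψ₀⟩}(𝓗_a,𝓗_b)`** for a unitary process with a pure probe, where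
`cov(A,B) = ½⟨{A,B}⟩ − ⟨A⟩⟨B⟩`: with `|ψ⟩ = U|ψ₀⟩`, `|∂_aψ⟩ = iU𝓗_a|ψ₀⟩` and any Hermitian SLDs of `|ψ⟩⟨ψ|`,
`F_ab = 4(½Re⟨ψ₀|(𝓗_a𝓗_b + 𝓗_b𝓗_a)|ψ₀⟩ − Re⟨𝓗_a⟩Re⟨𝓗_b⟩)`. [cite: LiuYuanLuWang2020, §2.3.4 Cor. 3] -/
theorem qfim_unitary_pure {U : Matrix n n ℂ} (hU : Uᴴ * U = 1) {Hc : ι → Matrix n n ℂ}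
    (hH : ∀ a, (Hc a).IsHermitian) {ψ₀ : n → ℂ} (hψ₀ : star ψ₀ ⬝ᵥ ψ₀ = 1) {S : ι → Matrix n n ℂ}
    (hSD : ∀ a, S a * vecMulVec (U *ᵥ ψ₀) (star (U *ᵥ ψ₀)) + vecMulVec (U *ᵥ ψ₀) (star (U *ᵥ ψ₀)) * S a =
      vecMulVec (Complex.I • (U *ᵥ (Hc a *ᵥ ψ₀))) (star (U *ᵥ ψ₀)) +
        vecMulVec (U *ᵥ ψ₀) (star (Complex.I • (U *ᵥ (Hc a *ᵥ ψ₀)))))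
    {F : Matrix ι ι ℝ}
    (hF : ∀ a b, F a b = 2 * (S a * (vecMulVec (Complex.I • (U *ᵥ (Hc b *ᵥ ψ₀))) (star (U *ᵥ ψ₀)) +
      vecMulVec (U *ᵥ ψ₀) (star (Complex.I • (U *ᵥ (Hc b *ᵥ ψ₀)))))).trace.re) (a b : ι) :
    F a b = 4 * ((star ψ₀ ⬝ᵥ ((Hc a * Hc b + Hc b * Hc a) *ᵥ ψ₀)).re / 2 -
      (star ψ₀ ⬝ᵥ (Hc a *ᵥ ψ₀)).re * (star ψ₀ ⬝ᵥ (Hc b *ᵥ ψ₀)).re) := by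
  obtain ⟨Q, hQ⟩ : ∃ Q : Matrix ι ι ℂ, ∀ a b, Q a b =
      star (Complex.I • (U *ᵥ (Hc a *ᵥ ψ₀))) ⬝ᵥ (Complex.I • (U *ᵥ (Hc b *ᵥ ψ₀))) -
      (star (Complex.I • (U *ᵥ (Hc a *ᵥ ψ₀))) ⬝ᵥ (U *ᵥ ψ₀)) * (star (U *ᵥ ψ₀) ⬝ᵥ (Complex.I • (U *ᵥ (Hc b *ᵥ ψ₀)))) :=
    ⟨Matrix.of fun a b => _, fun _ _ => rfl⟩
  rw [qfim_eq_four_re_qgt (norm_unitary_probe hU hψ₀) (re_inner_deriv_unitary hU hH ψ₀) hSD hF hQ,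
    qgt_unitary hU hH ψ₀ hQ]
  -- real parts: `Re⟨𝓗_a𝓗_b⟩ = ½Re⟨{𝓗_a,𝓗_b}⟩`, expectations are real
  have hab : star (star ψ₀ ⬝ᵥ ((Hc a * Hc b) *ᵥ ψ₀)) = star ψ₀ ⬝ᵥ ((Hc b * Hc a) *ᵥ ψ₀) := by
    rw [← star_dotProduct_star, star_star, star_mulVec, conjTranspose_mul, (hH a).eq, (hH b).eq,
      ← dotProduct_mulVec]
  have hre2 : (star ψ₀ ⬝ᵥ ((Hc a * Hc b + Hc b * Hc a) *ᵥ ψ₀)).re = 2 * (star ψ₀ ⬝ᵥ ((Hc a * Hc b) *ᵥ ψ₀)).re := by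
    rw [add_mulVec, dotProduct_add, ← hab, Complex.add_re, Complex.star_def, Complex.conj_re, two_mul]
  have hima : (star ψ₀ ⬝ᵥ (Hc a *ᵥ ψ₀)).im = 0 := by
    have h := star_expect (hH a) ψ₀
    rw [Complex.star_def] at h
    exact Complex.conj_eq_iff_im.mp h
  rw [hre2, Complex.sub_re, Complex.mul_re, hima, zero_mul, sub_zero]
  ring

/-- **Corollary 10: for a unitary process with a pure probe, `Im⟨∂_aψ|∂_bψ⟩ = 0 ⇔ ⟨ψ₀|[𝓗_a,𝓗_b]|ψ₀⟩ = 0`**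
(`2i·Im⟨ψ₀|𝓗_a𝓗_b|ψ₀⟩ = ⟨ψ₀|[𝓗_a,𝓗_b]|ψ₀⟩`). [cite: LiuYuanLuWang2020, §3.1.2 Cor. 10] -/
theorem im_inner_deriv_unitary_eq_zero_iff {U : Matrix n n ℂ} (hU : Uᴴ * U = 1) {Hc : ι → Matrix n n ℂ}
    (hH : ∀ a, (Hc a).IsHermitian) (ψ₀ : n → ℂ) (a b : ι) :
    (star (Complex.I • (U *ᵥ (Hc a *ᵥ ψ₀))) ⬝ᵥ (Complex.I • (U *ᵥ (Hc b *ᵥ ψ₀)))).im = 0 ↔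
      star ψ₀ ⬝ᵥ ((Hc a * Hc b - Hc b * Hc a) *ᵥ ψ₀) = 0 := by
  rw [inner_deriv_deriv_unitary hU hH]
  have hab : star (star ψ₀ ⬝ᵥ ((Hc a * Hc b) *ᵥ ψ₀)) = star ψ₀ ⬝ᵥ ((Hc b * Hc a) *ᵥ ψ₀) := by
    rw [← star_dotProduct_star, star_star, star_mulVec, conjTranspose_mul, (hH a).eq, (hH b).eq,
      ← dotProduct_mulVec]
  have hcomm : star ψ₀ ⬝ᵥ ((Hc a * Hc b - Hc b * Hc a) *ᵥ ψ₀) =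
      2 * Complex.I * ((star ψ₀ ⬝ᵥ ((Hc a * Hc b) *ᵥ ψ₀)).im : ℂ) := by
    rw [sub_mulVec, dotProduct_sub, ← hab, Complex.star_def, Complex.sub_conj]
    push_cast
    ring
  rw [hcomm, mul_eq_zero, mul_eq_zero, Complex.ofReal_eq_zero]
  simp [Complex.I_ne_zero]

end Unitary

end Literature.InformationTheory.StateDiscrimination.PureQGT

end
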